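import Literature.NumberTheory.EllipticCurves.GeomPointReduction
import Literature.NumberTheory.EllipticCurves.SupersingularDivisionPolynomialProofs
import HarnessLib

/-!
# At a place of good supersingular reduction, all `p`-power torsion lies in the kernel of reduction `E₁`

`Proofs`-style file (THEOREMS ONLY: no definition, no named fact, no instance), topic `NumberTheory/EllipticCurves`.
Complement to Silverman AEC VII.3.1 (prime-to-`p` torsion INJECTS into the reduction, tree
`eq_zero_of_zsmul_eq_zero_of_goodReductionHom_eq_zero`): for a Weierstrass equation `W` with unit discriminant
(good reduction) over a valuation ring `R` of `K` (`hv : v.Integers R`) whose reduction `W̃ = W mod 𝔪` has NO point of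
order `p` over the residue field — the case of good **supersingular** reduction in residue characteristic `p`
(`Ẽ(k̄)[p] = 0`, AEC V.3.1(a); tree `eq_zero_of_prime_nsmul_eq_zero_of_hasseCoeff_eq_zero`) — every `K`-point killed by
a power of `p` lies in the kernel of reduction `E₁(K)` (`P = O` or `x(P) ∉ R`), because the total reduction map
`E(K) → Ẽ(k)` is a homomorphism (AEC VII.2.1, tree `goodReductionHom`).

* `eq_zero_of_pow_smul_eq_zero_of_forall_prime_smul` — in a group without `p`-torsion there is no `pⁿ`-torsion;
* `reducesToZero_of_pow_prime_smul_eq_zero` — the abstract statement (hypothesis: `Ẽ(k)` has no point of order `p`);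
* `reducesToZero_of_pow_prime_smul_eq_zero_of_hasseCoeff_eq_zero` — finite residue field of odd characteristic `p`
  and Hasse invariant `A_p(W̃) = 0`;
* `one_lt_v_X_of_pow_prime_smul_eq_zero…` — valuation form: `v(x(P)) > 1` for every affine `pⁿ`-torsion point, so
  that its parameter `z = -x/y` lies in the maximal ideal (the formal group carries ALL the `p`-power torsion:
  `E[p^∞] ⊂ Ê(𝔪)`, the input of the Tate-module matching `T_pE ≅ T_pÊ` at supersingular places; Serre 1972 §1.11);
* `reducesToZero_of_pow_prime_smul_reducesToZero…` — the same for DIVISION points: if `pⁿ • Q ∈ E₁(K)` then `Q ∈ E₁(K)`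
  (division sequences of formal points are formal; the input of the Kummer theory of `Ê`).

BSD / K★ (`Cruxes/StarredOptimalManinUnitFiveSeven/Lines/kato-lever-hDR-sector-iii-periods.md` §5 (M2)): infrastructure for
the potentially supersingular cells; nothing about elliptic curves over number fields is proved here.

## References
* J. H. Silverman, *The Arithmetic of Elliptic Curves*, 2nd ed. (2009), Prop. VII.2.1, VII.2.2, Prop. VII.3.1, Thm. V.3.1(a).
  [SilvermanAEC2009]
* J.-P. Serre, *Propriétés galoisiennes des points d'ordre fini des courbes elliptiques*, Invent. Math. 15 (1972), §1.11.
  [Serre1972]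
-/

noncomputable section

open scoped Classical

namespace Literature.NumberTheory.EllipticCurves

/-! ### No `p`-torsion ⇒ no `pⁿ`-torsion -/

/-- In an additive group in which `p • Q = 0 ⇒ Q = 0`, also `pⁿ • Q = 0 ⇒ Q = 0`. [folklore] -/
private theorem eq_zero_of_pow_smul_eq_zero_of_forall_prime_smul {A : Type*} [AddCommGroup A] {p : ℕ}
    (h : ∀ Q : A, (p : ℤ) • Q = 0 → Q = 0) : ∀ (n : ℕ) (Q : A), (p ^ n : ℤ) • Q = 0 → Q = 0 := by
  intro n
  induction n with
  | zero => intro Q hQ; rwa [pow_zero, one_smul] at hQ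
  | succ n ih =>
    intro Q hQ
    rw [pow_succ', mul_smul] at hQ
    exact ih Q (h _ hQ)

/-! ### Good reduction with `Ẽ(k)[p] = 0`: `E[pⁿ] ⊂ E₁` -/

section ValuationRing

variable {K : Type*} [Field K] {Γ₀ : Type*} [LinearOrderedCommGroupWithZero Γ₀]
  {v : Valuation K Γ₀} {R : Type*} [CommRing R] [IsLocalRing R] [Algebra R K]
  {W : WeierstrassCurve R}

/-- **`E[pⁿ](K) ⊂ E₁(K)` when the reduction has no point of order `p`.** For a Weierstrass equation with unit
discriminant over a valuation ring `R` of `K` whose reduced curve has no `k`-point of order `p`, every `K`-point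
killed by `pⁿ` reduces to `Õ`, i.e. lies in the kernel of reduction (the reduction map is a homomorphism,
AEC VII.2.1, and `P̃` would be a `pⁿ`-torsion point of `Ẽ(k)`). [cite: SilvermanAEC2009, Prop. VII.2.1] -/
theorem reducesToZero_of_pow_prime_smul_eq_zero (hv : v.Integers R) (hΔ : IsUnit W.Δ) {p : ℕ}
    (hss : ∀ Q : (W.map (IsLocalRing.residue R)).toAffine.Point, (p : ℤ) • Q = 0 → Q = 0)
    {n : ℕ} {P : (W.baseChange K).toAffine.Point} (hP : (p ^ n : ℤ) • P = 0) :
    WeierstrassCurve.ReducesToZero W P := by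
  rw [← goodReductionHom_eq_zero_iff hv hΔ]
  refine eq_zero_of_pow_smul_eq_zero_of_forall_prime_smul hss n _ ?_
  rw [← map_zsmul, hP, map_zero]

/-- Valuation form: an AFFINE `pⁿ`-torsion point has `v(x) > 1` (its `x`-coordinate is not integral) when the
reduction has no point of order `p`. [cite: SilvermanAEC2009, Prop. VII.2.1] -/
theorem one_lt_v_X_of_pow_prime_smul_eq_zero (hv : v.Integers R) (hΔ : IsUnit W.Δ) {p : ℕ}
    (hss : ∀ Q : (W.map (IsLocalRing.residue R)).toAffine.Point, (p : ℤ) • Q = 0 → Q = 0)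
    {n : ℕ} {x y : K} {h : (W.baseChange K).toAffine.Nonsingular x y}
    (hP : (p ^ n : ℤ) • (WeierstrassCurve.Affine.Point.some x y h) = 0) : 1 < v x :=
  (not_mem_range_iff hv).mp
    ((WeierstrassCurve.reducesToZero_some_iff h).mp (reducesToZero_of_pow_prime_smul_eq_zero hv hΔ hss hP))

/-- **Good SUPERSINGULAR reduction: `E[pⁿ](K) ⊂ E₁(K)`.** For a Weierstrass equation with unit discriminant over a
valuation ring `R` of `K` with finite residue field `k` of odd characteristic `p` and vanishing Hasse invariant
`A_p(W̃) = 0` (supersingular reduction: `Ẽ(k)` has no point of order `p`, AEC V.3.1(a)), every `K`-point killed by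
`pⁿ` lies in the kernel of reduction. [cite: SilvermanAEC2009, Thm. V.3.1(a) and Prop. VII.2.1] -/
theorem reducesToZero_of_pow_prime_smul_eq_zero_of_hasseCoeff_eq_zero (hv : v.Integers R) (hΔ : IsUnit W.Δ)
    {p : ℕ} [Fact p.Prime] (hp2 : p ≠ 2) [Finite (IsLocalRing.ResidueField R)] [CharP (IsLocalRing.ResidueField R) p]
    (hA : (W.map (IsLocalRing.residue R)).hasseCoeff p = 0)
    {n : ℕ} {P : (W.baseChange K).toAffine.Point} (hP : (p ^ n : ℤ) • P = 0) :
    WeierstrassCurve.ReducesToZero W P := by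
  haveI := isElliptic_map_residue (W := W) hΔ
  letI : Fintype (IsLocalRing.ResidueField R) := Fintype.ofFinite _
  refine reducesToZero_of_pow_prime_smul_eq_zero hv hΔ (fun Q hQ => ?_) hP
  exact (W.map (IsLocalRing.residue R)).eq_zero_of_prime_nsmul_eq_zero_of_hasseCoeff_eq_zero p hp2 hA Q
    (by rw [← natCast_zsmul]; exact hQ)

/-- Valuation form of the supersingular case: an affine `pⁿ`-torsion point has `v(x) > 1`, so `x ∉ R` and its parameter
`z = -x/y` lies in the maximal ideal — the formal group `Ê(𝔪)` carries all the `p`-power torsion (Serre 1972 §1.11).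
[cite: SilvermanAEC2009, Thm. V.3.1(a) and Prop. VII.2.2] [cite: Serre1972, §1.11] -/
theorem one_lt_v_X_of_pow_prime_smul_eq_zero_of_hasseCoeff_eq_zero (hv : v.Integers R) (hΔ : IsUnit W.Δ)
    {p : ℕ} [Fact p.Prime] (hp2 : p ≠ 2) [Finite (IsLocalRing.ResidueField R)] [CharP (IsLocalRing.ResidueField R) p]
    (hA : (W.map (IsLocalRing.residue R)).hasseCoeff p = 0)
    {n : ℕ} {x y : K} {h : (W.baseChange K).toAffine.Nonsingular x y}
    (hP : (p ^ n : ℤ) • (WeierstrassCurve.Affine.Point.some x y h) = 0) : 1 < v x :=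
  (not_mem_range_iff hv).mp ((WeierstrassCurve.reducesToZero_some_iff h).mp
    (reducesToZero_of_pow_prime_smul_eq_zero_of_hasseCoeff_eq_zero hv hΔ hp2 hA hP))

/-- Under the same hypotheses the `pⁿ`-torsion meets the integral points only in `O`: a `pⁿ`-torsion point with
`x(P) ∈ R` is `O`. [cite: SilvermanAEC2009, Thm. V.3.1(a) and Prop. VII.2.1] -/
theorem eq_zero_of_pow_prime_smul_eq_zero_of_mem_range (hv : v.Integers R) (hΔ : IsUnit W.Δ) {p : ℕ}
    (hss : ∀ Q : (W.map (IsLocalRing.residue R)).toAffine.Point, (p : ℤ) • Q = 0 → Q = 0)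
    {n : ℕ} {P : (W.baseChange K).toAffine.Point} (hP : (p ^ n : ℤ) • P = 0)
    (hint : ∀ x y h, P = WeierstrassCurve.Affine.Point.some x y h → x ∈ Set.range (algebraMap R K)) : P = 0 := by
  rcases P with _ | ⟨x, y, h⟩
  · rfl
  · exact absurd (hint x y h rfl)
      ((WeierstrassCurve.reducesToZero_some_iff h).mp (reducesToZero_of_pow_prime_smul_eq_zero hv hΔ hss hP))

/-! ### Division points of points of the kernel of reduction -/

/-- **Division points of a point of `E₁(K)` stay in `E₁(K)`** when the reduction has no point of order `p`: if `pⁿ • Q`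
reduces to `Õ` then so does `Q` (the reduction map is a homomorphism and `P̃ ↦ pⁿ P̃` has trivial kernel on `Ẽ(k)`). So every
`p`-power DIVISION sequence of a point of the kernel of reduction consists of points of the kernel — division sequences of formal
points are formal (the input of the Kummer theory of the formal group at such places). [cite: SilvermanAEC2009, Prop. VII.2.1] -/
theorem reducesToZero_of_pow_prime_smul_reducesToZero (hv : v.Integers R) (hΔ : IsUnit W.Δ) {p : ℕ}
    (hss : ∀ Q : (W.map (IsLocalRing.residue R)).toAffine.Point, (p : ℤ) • Q = 0 → Q = 0)
    {n : ℕ} {Q : (W.baseChange K).toAffine.Point} (hQ : WeierstrassCurve.ReducesToZero W ((p ^ n : ℤ) • Q)) :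
    WeierstrassCurve.ReducesToZero W Q := by
  rw [← goodReductionHom_eq_zero_iff hv hΔ] at hQ ⊢
  refine eq_zero_of_pow_smul_eq_zero_of_forall_prime_smul hss n _ ?_
  rw [← map_zsmul]
  exact hQ

/-- **Good SUPERSINGULAR reduction: division points of points of `E₁(K)` lie in `E₁(K)`** (finite residue field of odd
characteristic `p`, Hasse invariant `A_p(W̃) = 0`, so `Ẽ(k)` has no point of order `p`, AEC V.3.1(a)): if `pⁿ • Q` reduces to `Õ`
then so does `Q`. [cite: SilvermanAEC2009, Thm. V.3.1(a) and Prop. VII.2.1] [cite: Serre1972, §1.11] -/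
theorem reducesToZero_of_pow_prime_smul_reducesToZero_of_hasseCoeff_eq_zero (hv : v.Integers R) (hΔ : IsUnit W.Δ)
    {p : ℕ} [Fact p.Prime] (hp2 : p ≠ 2) [Finite (IsLocalRing.ResidueField R)] [CharP (IsLocalRing.ResidueField R) p]
    (hA : (W.map (IsLocalRing.residue R)).hasseCoeff p = 0)
    {n : ℕ} {Q : (W.baseChange K).toAffine.Point} (hQ : WeierstrassCurve.ReducesToZero W ((p ^ n : ℤ) • Q)) :
    WeierstrassCurve.ReducesToZero W Q := by
  haveI := isElliptic_map_residue (W := W) hΔ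
  letI : Fintype (IsLocalRing.ResidueField R) := Fintype.ofFinite _
  refine reducesToZero_of_pow_prime_smul_reducesToZero hv hΔ (fun Q' hQ' => ?_) hQ
  exact (W.map (IsLocalRing.residue R)).eq_zero_of_prime_nsmul_eq_zero_of_hasseCoeff_eq_zero p hp2 hA Q'
    (by rw [← natCast_zsmul]; exact hQ')

/-- Valuation form: if `pⁿ • (x, y)` reduces to `Õ` (e.g. it is a point of the formal group `Ê(𝔪)`), then `v(x) > 1`, i.e. the
parameter `z = -x/y` of the division point lies in the maximal ideal. [cite: SilvermanAEC2009, Thm. V.3.1(a) and Prop. VII.2.2] -/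
theorem one_lt_v_X_of_pow_prime_smul_reducesToZero_of_hasseCoeff_eq_zero (hv : v.Integers R) (hΔ : IsUnit W.Δ)
    {p : ℕ} [Fact p.Prime] (hp2 : p ≠ 2) [Finite (IsLocalRing.ResidueField R)] [CharP (IsLocalRing.ResidueField R) p]
    (hA : (W.map (IsLocalRing.residue R)).hasseCoeff p = 0)
    {n : ℕ} {x y : K} {h : (W.baseChange K).toAffine.Nonsingular x y}
    (hQ : WeierstrassCurve.ReducesToZero W ((p ^ n : ℤ) • (WeierstrassCurve.Affine.Point.some x y h))) : 1 < v x :=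
  (not_mem_range_iff hv).mp ((WeierstrassCurve.reducesToZero_some_iff h).mp
    (reducesToZero_of_pow_prime_smul_reducesToZero_of_hasseCoeff_eq_zero hv hΔ hp2 hA hQ))

end ValuationRing

end Literature.NumberTheory.EllipticCurves

end
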